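import Summits.Parity.GeneralizedHardyLittlewood.Theorems.BeyondDiagonalBeatsQuarter.PeterssonSplit
import Summits.Parity.GeneralizedHardyLittlewood.Theorems.BeyondDiagonalBeatsQuarter.CleanScales

/-!
# W3 consumer-fit certificate (ls-ref-1 g17): H4 (`QhPQ_X_sq_one_split`, p632742) composes with the
# registered heart's left side (`kernelExcess`, CleanScales) and H1's corner kernel
# (`Corner.trueDiagKernel_sub_kmvKernel`): for `q` prime with `1 ≤ q̂^{Δ′} < q`,
# `E(Δ′,q) = 2q̂·Σ x_l x_m·hKernel cornerE q̂ l m − re Σ (x_l l^{−1/2})(x_m m^{−1/2})·OFF_q(l,m)`.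
Identity only; closes nothing; candidate helper for a prover to land (refuter lane cannot).
«The programme SEARCHES and TYPES; no claim about Landau–Siegel zeros, Theorems 1–2 of arXiv:2211.02515 or
a repaired Margin232 until a kernel theorem says so.»
-/

noncomputable section

open Finset Polynomial
open scoped Real ArithmeticFunction.Moebius

namespace Summit.Parity.GeneralizedHardyLittlewood.Theorems.BeyondDiagonalBeatsQuarter

open Literature.NumberTheory.LFunctions Literature.NumberTheory.LFunctions.KMV2000
open KernelFormXSq (xsq)
open PeterssonSplit (offDiag QhPQ_X_sq_one_split)

/-- The heart's coefficient is `xsq`: `μ(m)·(ψ(m)⁻¹·(X²)(t)) = xsq M m` at `t = log(M/m)/log M`.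
[cite: KowalskiMichelVanderKam2000, (9) p. 7 — derivation] -/
theorem heartCoeff_eq_xsq (M : ℝ) (m : ℕ) :
    (ArithmeticFunction.moebius m : ℝ) *
        ((KMV2000.psi m)⁻¹ * (X ^ 2 : ℝ[X]).eval (Real.log (M / m) / Real.log M)) = xsq M m := by
  simp only [xsq, eval_pow, eval_X]

/-- **H4 meets the heart.** For `q` prime and `1 ≤ q̂^{Δ′} < q`:
`kernelExcess Δ′ q = 2q̂·Σ_{l,m ≤ q̂^{Δ′}} x_l x_m·hKernel cornerE q̂ l m
  − re Σ_{l,m ≤ q̂^{Δ′}} (mollifierCoeff X² l)(mollifierCoeff X² m)·OFF_q(l,m)`.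
[cite: KowalskiMichelVanderKam2000, (21)–(23) pp. 12–13 and §6 p. 19 — derivation] -/
theorem kernelExcess_eq_corner_sub_off {q : ℕ} [NeZero q] (hq : q.Prime) {Δ' : ℝ}
    (h1 : 1 ≤ KMV2000.qhat q ^ Δ') (h2 : KMV2000.qhat q ^ Δ' < q) :
    kernelExcess Δ' q =
      2 * KMV2000.qhat q *
          ∑ l ∈ Icc 1 ⌊KMV2000.qhat q ^ Δ'⌋₊, ∑ m ∈ Icc 1 ⌊KMV2000.qhat q ^ Δ'⌋₊,
            xsq (KMV2000.qhat q ^ Δ') l * xsq (KMV2000.qhat q ^ Δ') m *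
              Corner.hKernel Corner.cornerE (KMV2000.qhat q) l m -
        (∑ l ∈ Icc 1 ⌊KMV2000.qhat q ^ Δ'⌋₊, ∑ m ∈ Icc 1 ⌊KMV2000.qhat q ^ Δ'⌋₊,
            ((mollifierCoeff (X ^ 2) (KMV2000.qhat q ^ Δ') l *
                mollifierCoeff (X ^ 2) (KMV2000.qhat q ^ Δ') m : ℝ) : ℂ) * offDiag q l m).re := by
  set M : ℝ := KMV2000.qhat q ^ Δ' with hM
  have hQ : 0 < KMV2000.qhat q := qhat_pos hq.one_lt.le
  rw [kernelExcess_eq, QhPQ_X_sq_one_split hq h1 h2, Complex.sub_re, Complex.ofReal_re]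
  simp_rw [heartCoeff_eq_xsq]
  have hK : ∀ l ∈ Icc 1 ⌊M⌋₊, ∀ m ∈ Icc 1 ⌊M⌋₊,
      xsq M l * xsq M m * Corner.hKernel Corner.cornerE (KMV2000.qhat q) l m =
        xsq M l * xsq M m * Corner.trueDiagKernel (KMV2000.qhat q) l m -
          xsq M l * xsq M m * KMV2000.kmvKernel (Real.log (KMV2000.qhat q)) l m := by
    intro l hl m hm
    have hl0 : l ≠ 0 := by have := (Finset.mem_Icc.1 hl).1; omega
    have hm0 : m ≠ 0 := by have := (Finset.mem_Icc.1 hm).1; omega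
    rw [← Corner.trueDiagKernel_sub_kmvKernel hQ hl0 hm0]
    ring
  rw [Finset.sum_congr rfl fun l hl ↦ Finset.sum_congr rfl fun m hm ↦ hK l hl m hm]
  simp only [Finset.sum_sub_distrib, mul_sub]
  ring
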